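import Summits.QuantumFields.QCD.Theorems.WilsonMobilityGapMobilityGapSketchWindow
import Literature.Barriers.QuantumFields.WilsonDeterminantMassSplitting

/-!
# Crux `MobilityGap` (stmt-QuantumFields-9150) — line `Sketch`: the three-flavour sign clause from the
# refined DEEP + WINDOW count of real modes (registered sub-goal `sign_of_deepWindow_three`)

Helper file `--supports stmt-QuantumFields-9150` of lead seat prover-line-stmt-QuantumFields-9150-c4-0.

The landed `PositivityDeficitLeDefects` charges, for clause (iv) of the crux (sign coherence
`½ ≤ |∫ det D dμ_W| / ∫ |det D| dμ_W`), EVERY deep real-mode crosser of EVERY flavour: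
`(1 − ⟨sign⟩₊)/2 ≤ E₊[Σ_f #{real eigenvalues of D_W(U,0,1) below −t_f}]`.  For three flavours this is refined
here to the count DEEP + WINDOW, where DEEP is the number (with algebraic multiplicity) of real eigenvalues of
`D_W(U,0,1)` below ALL the `−t_f` (each deep crosser counted once, not thrice) and WINDOW the number of real
eigenvalues strictly inside the spread window (below some `−t_f` and above some `−t_g`).  The Wilson determinant
`t ↦ det D_W(U,t,1)` is a real polynomial in the bare mass (`γ₅`-hermiticity, `D_W(t) = D_W(0) + t`); if the
three-flavour weight `Π_f det D_W(t_f)` is negative then either the heaviest flavour `f*` already has a negative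
determinant — and then `D_W(U,0,1)` has a real eigenvalue strictly below `−t_{f*} = −max t` (landed
`one_le_countP_of_re_fermionDet_neg`: IVT between `t_{f*}` and `+∞`), a DEEP mode — or it is positive and some
lighter flavour `f₁` has a negative determinant, so the pair weight `det D_W(t_{f₁})·det D_W(t_{f*})` is negative
and the mass-splitting lemma (landed `one_le_countP_window_of_re_mul_neg`, IVT between the two masses; barrier
`Literature.Barriers.QuantumFields.WilsonDeterminantMassSplitting`) gives a real eigenvalue in
`(−t_{f*}, −t_{f₁})`, a WINDOW mode.

§1 the deep / window predicates as threshold predicates and the measurability of both counts (from the landed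
`measurable_countP_charpoly_roots_real_lt` and `measurable_countP_charpoly_roots_window`) · §2 the configurationwise
lemma and the pointwise bound `Π|det| − Re Π det ≤ 2·(DEEP + WINDOW)·Π|det|` · §3 the integrated deficit bound
`(1 − ⟨sign⟩₊)/2 ≤ E₊[DEEP + WINDOW]` · §4 the registered sub-goal `sign_of_deepWindow_three`: a phase-quenched
expected DEEP + WINDOW count `≤ 1/4` gives clause (iv) for three flavours.
-/

noncomputable section

namespace Summit.QuantumFields.QCD.Theorems.MobilityGapSketch

open scoped BigOperators Topology
open MeasureTheory Filter Set
open Literature.MathematicalPhysics.QuantumFieldTheory Literature.MathematicalPhysics.QuantumLattice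
  Literature.Probability.LatticeModels

/-! ### §1 Deep and window predicates as thresholds; measurability of the two counts -/

section Family

variable {X : Type*} [TopologicalSpace X] {n : Type*} [Fintype n] [DecidableEq n]

/-- Below all of finitely many thresholds `−t f` iff below the least of them, `−max_f t f`. [folklore] -/
theorem forall_lt_neg_iff_lt_neg_sup' {ι : Type*} [Fintype ι] [Nonempty ι] (t : ι → ℝ) (x : ℝ) :
    (∀ f, x < -t f) ↔ x < -Finset.univ.sup' Finset.univ_nonempty t := by
  constructor
  · intro h
    obtain ⟨i, -, hi⟩ := Finset.exists_mem_eq_sup' Finset.univ_nonempty t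
    rw [hi]
    exact h i
  · intro h f
    exact lt_of_lt_of_le h (neg_le_neg (Finset.le_sup' t (Finset.mem_univ f)))

/-- Inside the open spread window — below some `−t f` and above some `−t g` — iff strictly between
`−max_f t f` and `−min_f t f`. [folklore] -/
theorem exists_lt_neg_and_exists_neg_lt_iff {ι : Type*} [Fintype ι] [Nonempty ι] (t : ι → ℝ) (x : ℝ) :
    ((∃ f, x < -t f) ∧ ∃ g, -t g < x) ↔
      -Finset.univ.sup' Finset.univ_nonempty t < x ∧ x < -Finset.univ.inf' Finset.univ_nonempty t := by
  constructor
  · rintro ⟨⟨f, hf⟩, g, hg⟩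
    exact ⟨lt_of_le_of_lt (neg_le_neg (Finset.le_sup' t (Finset.mem_univ g))) hg,
      lt_of_lt_of_le hf (neg_le_neg (Finset.inf'_le t (Finset.mem_univ f)))⟩
  · rintro ⟨h₁, h₂⟩
    obtain ⟨i, -, hi⟩ := Finset.exists_mem_eq_inf' Finset.univ_nonempty t
    obtain ⟨j, -, hj⟩ := Finset.exists_mem_eq_sup' Finset.univ_nonempty t
    exact ⟨⟨i, by rw [← hi]; exact h₂⟩, ⟨j, by rw [← hj]; exact h₁⟩⟩

/-- **Measurability of the deep count.**  For a continuous matrix family `A` on a sequential space with a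
Borel-compatible σ-algebra and finitely many thresholds `t f`, `f : Fin m`, `m ≥ 1`, the number (with algebraic
multiplicity) of REAL eigenvalues of `A x` below all the `−t f` is a measurable function of `x`: it is the landed
measurable count below the single threshold `−max_f t f` (`measurable_countP_charpoly_roots_real_lt`).  (Stated for
`Fin m` so that the decidability instances are the ones elaborated in the crux statement.) [folklore] -/
theorem measurable_countP_charpoly_roots_deep [SequentialSpace X] [MeasurableSpace X]
    [OpensMeasurableSpace X] {A : X → Matrix n n ℂ} (hA : Continuous A) {m : ℕ} [NeZero m]
    (t : Fin m → ℝ) :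
    Measurable fun x => (A x).charpoly.roots.countP fun z => z.im = 0 ∧ ∀ f, z.re < -t f := by
  classical
  have hfun : (fun x => (A x).charpoly.roots.countP fun z => z.im = 0 ∧ ∀ f, z.re < -t f) =
      fun x => (A x).charpoly.roots.countP
        fun z => z.im = 0 ∧ z.re < -Finset.univ.sup' Finset.univ_nonempty t := by
    funext x
    exact Multiset.countP_congr rfl fun z _ =>
      propext (and_congr_right fun _ => forall_lt_neg_iff_lt_neg_sup' t z.re)
  rw [hfun]
  exact PositivityDeficitLeDefects.measurable_countP_charpoly_roots_real_lt hA _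

/-- **Measurability of the window count.**  For a continuous matrix family `A` on a sequential space with a
Borel-compatible σ-algebra and finitely many thresholds `t f`, `f : Fin m`, `m ≥ 1`, the number (with algebraic
multiplicity) of REAL eigenvalues of `A x` lying below some `−t f` and above some `−t g` is a measurable function
of `x`: it is the landed measurable count of the open window `(−max_f t f, −min_f t f)`
(`measurable_countP_charpoly_roots_window`). [folklore] -/
theorem measurable_countP_charpoly_roots_spread [SequentialSpace X] [MeasurableSpace X]
    [OpensMeasurableSpace X] {A : X → Matrix n n ℂ} (hA : Continuous A) {m : ℕ} [NeZero m]
    (t : Fin m → ℝ) :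
    Measurable fun x => (A x).charpoly.roots.countP
      fun z => z.im = 0 ∧ (∃ f, z.re < -t f) ∧ ∃ g, -t g < z.re := by
  classical
  have hfun : (fun x => (A x).charpoly.roots.countP
      fun z => z.im = 0 ∧ (∃ f, z.re < -t f) ∧ ∃ g, -t g < z.re) =
      fun x => (A x).charpoly.roots.countP
        fun z => z.im = 0 ∧ -Finset.univ.sup' Finset.univ_nonempty t < z.re ∧
          z.re < -Finset.univ.inf' Finset.univ_nonempty t := by
    funext x
    exact Multiset.countP_congr rfl fun z _ =>
      propext (and_congr_right fun _ => exists_lt_neg_and_exists_neg_lt_iff t z.re)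
  rw [hfun]
  exact measurable_countP_charpoly_roots_window hA _ _

end Family

/-! ### §2 Three flavours: a negative weight forces a deep mode or a window mode -/

variable {N : ℕ} [NeZero N]

/-- **Sign ⇒ deep or window mode, configurationwise (three flavours).**  If the three-flavour Wilson weight
`Re Π_f det D_W(U,t_f,1)` is negative, then `D_W(U,0,1)` has a real eigenvalue (counted with algebraic
multiplicity as a root of the characteristic polynomial) either strictly below all the `−t_f` (DEEP) or strictly
inside the spread window, below some `−t_f` and above some `−t_g` (WINDOW).  All determinants are real; some
factor is negative; with `f*` the heaviest flavour: if `det D_W(t_{f*}) < 0` the landed single-flavour IVT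
`one_le_countP_of_re_fermionDet_neg` gives a real mode below `−t_{f*} ≤ −t_f`; if `det D_W(t_{f*}) > 0` then for
a negative factor `f₁` the pair weight `det D_W(t_{f₁})·det D_W(t_{f*})` is negative and the mass-splitting lemma
`one_le_countP_window_of_re_mul_neg` gives a real mode in `(−t_{f*}, −t_{f₁})`; `det D_W(t_{f*}) = 0` would make
the weight vanish. -/
theorem one_le_countP_deep_add_countP_window_of_re_prod_neg
    (U : GaugeConfig 4 N (Matrix.specialUnitaryGroup (Fin 3) ℂ)) (t : Fin 3 → ℝ)
    (hneg : (∏ f : Fin 3, fermionDet (wilsonDirac (fundamentalRep (Fin 3)) U (t f) 1)).re < 0) :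
    1 ≤ (wilsonDirac (fundamentalRep (Fin 3)) U 0 1).charpoly.roots.countP
        (fun z : ℂ => z.im = 0 ∧ ∀ f, z.re < -t f) +
      (wilsonDirac (fundamentalRep (Fin 3)) U 0 1).charpoly.roots.countP
        (fun z : ℂ => z.im = 0 ∧ (∃ f, z.re < -t f) ∧ ∃ g, -t g < z.re) := by
  classical
  set det : Fin 3 → ℂ := fun f => fermionDet (wilsonDirac (fundamentalRep (Fin 3)) U (t f) 1) with hdet
  have him : ∀ f, (det f).im = 0 := fun f =>
    fermionDet_wilsonDirac_im_holds (fundamentalRep (Fin 3)) (fun g => fundamentalRep_mem_unitaryGroup g) U (t f) 1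
  have hreal : ∀ f, det f = (((det f).re : ℝ) : ℂ) := fun f => Complex.ext (by simp) (by simp [him f])
  have hprodre : (∏ f, det f).re = ∏ f, (det f).re := by
    have h1 : ∏ f, det f = (((∏ f, (det f).re : ℝ)) : ℂ) := by
      rw [Complex.ofReal_prod]
      exact Finset.prod_congr rfl fun f _ => hreal f
    rw [h1, Complex.ofReal_re]
  have hneg' : ∏ f, (det f).re < 0 := by rw [← hprodre]; exact hneg
  -- some factor is negative
  obtain ⟨f₁, hf₁⟩ : ∃ f, (det f).re < 0 := by
    by_contra hcon
    push Not at hcon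
    exact absurd hneg' (not_lt.2 (Finset.prod_nonneg fun f _ => hcon f))
  -- the heaviest flavour
  obtain ⟨fm, hfm⟩ := Finite.exists_max t
  rcases lt_trichotomy (det fm).re 0 with hlt | heq | hgt
  · -- a DEEP mode below `-t fm ≤ -t f`
    have h1 := PositivityDeficitLeDefects.one_le_countP_of_re_fermionDet_neg U (t fm) hlt
    have hmono : (wilsonDirac (fundamentalRep (Fin 3)) U 0 1).charpoly.roots.countP
          (fun z : ℂ => z.im = 0 ∧ z.re < -t fm) ≤
        (wilsonDirac (fundamentalRep (Fin 3)) U 0 1).charpoly.roots.countP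
          (fun z : ℂ => z.im = 0 ∧ ∀ f, z.re < -t f) := by
      rw [Multiset.countP_eq_card_filter, Multiset.countP_eq_card_filter]
      exact Multiset.card_le_card (Multiset.monotone_filter_right _ fun z hz =>
        ⟨hz.1, fun f => lt_of_lt_of_le hz.2 (neg_le_neg (hfm f))⟩)
    exact (h1.trans hmono).trans (Nat.le_add_right _ _)
  · -- a vanishing factor: the weight vanishes
    exfalso
    have h0 : ∏ f, (det f).re = 0 := Finset.prod_eq_zero (Finset.mem_univ fm) heq
    rw [h0] at hneg'
    exact lt_irrefl _ hneg'
  · -- a WINDOW mode strictly between `-t fm` and `-t f₁`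
    have h2 : (det f₁ * det fm).re < 0 := by
      rw [Complex.mul_re, him f₁, zero_mul, sub_zero]
      exact mul_neg_of_neg_of_pos hf₁ hgt
    have h3 := one_le_countP_window_of_re_mul_neg U (t f₁) (t fm) h2
    have hmono : (wilsonDirac (fundamentalRep (Fin 3)) U 0 1).charpoly.roots.countP
          (fun z : ℂ => z.im = 0 ∧ -max (t f₁) (t fm) < z.re ∧ z.re < -min (t f₁) (t fm)) ≤
        (wilsonDirac (fundamentalRep (Fin 3)) U 0 1).charpoly.roots.countP
          (fun z : ℂ => z.im = 0 ∧ (∃ f, z.re < -t f) ∧ ∃ g, -t g < z.re) := by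
      rw [Multiset.countP_eq_card_filter, Multiset.countP_eq_card_filter]
      refine Multiset.card_le_card (Multiset.monotone_filter_right _ fun z hz => ⟨hz.1, ⟨f₁, ?_⟩, ⟨fm, ?_⟩⟩)
      · have h := hz.2.2
        rwa [min_eq_left (hfm f₁)] at h
      · have h := hz.2.1
        rwa [max_eq_right (hfm f₁)] at h
    exact (h3.trans hmono).trans (Nat.le_add_left _ _)

/-- **Pointwise bound (three flavours, refined count).**  For every gauge field and `t : Fin 3 → ℝ`, with
`P = Π_f det D_W(t_f)`, `DEEP` the number of real eigenvalues of `D_W(U,0,1)` below all the `−t_f` and `WINDOW`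
the number of real eigenvalues below some `−t_f` and above some `−t_g`:
`Π_f |det D_W(t_f)| − Re P ≤ 2·(DEEP + WINDOW)·Π_f |det D_W(t_f)|`.  If `Re P ≥ 0` the left side vanishes (`P` is
real); otherwise `DEEP + WINDOW ≥ 1` and `−Re P ≤ |P|`. -/
theorem norm_sub_re_le_two_mul_deepWindowCount_mul_norm
    (U : GaugeConfig 4 N (Matrix.specialUnitaryGroup (Fin 3) ℂ)) (t : Fin 3 → ℝ) :
    (∏ f : Fin 3, ‖fermionDet (wilsonDirac (fundamentalRep (Fin 3)) U (t f) 1)‖) -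
        (∏ f : Fin 3, fermionDet (wilsonDirac (fundamentalRep (Fin 3)) U (t f) 1)).re ≤
      2 * ((((wilsonDirac (fundamentalRep (Fin 3)) U 0 1).charpoly.roots.countP
            (fun z : ℂ => z.im = 0 ∧ ∀ f, z.re < -t f) : ℝ) +
          ((wilsonDirac (fundamentalRep (Fin 3)) U 0 1).charpoly.roots.countP
            (fun z : ℂ => z.im = 0 ∧ (∃ f, z.re < -t f) ∧ ∃ g, -t g < z.re) : ℝ)) *
        ∏ f : Fin 3, ‖fermionDet (wilsonDirac (fundamentalRep (Fin 3)) U (t f) 1)‖) := by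
  classical
  set det : Fin 3 → ℂ := fun f => fermionDet (wilsonDirac (fundamentalRep (Fin 3)) U (t f) 1) with hdet
  have him : ∀ f, (det f).im = 0 := fun f =>
    fermionDet_wilsonDirac_im_holds (fundamentalRep (Fin 3)) (fun g => fundamentalRep_mem_unitaryGroup g) U (t f) 1
  have hreal : ∀ f, det f = (((det f).re : ℝ) : ℂ) := fun f => Complex.ext (by simp) (by simp [him f])
  have hPim : (∏ f, det f).im = 0 := by
    have h1 : ∏ f, det f = (((∏ f, (det f).re : ℝ)) : ℂ) := by
      rw [Complex.ofReal_prod]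
      exact Finset.prod_congr rfl fun f _ => hreal f
    rw [h1, Complex.ofReal_im]
  have hA0 : 0 ≤ ∏ f, ‖det f‖ := Finset.prod_nonneg fun f _ => norm_nonneg _
  have hW0 : (0 : ℝ) ≤ (((wilsonDirac (fundamentalRep (Fin 3)) U 0 1).charpoly.roots.countP
        (fun z : ℂ => z.im = 0 ∧ ∀ f, z.re < -t f) : ℝ) +
      ((wilsonDirac (fundamentalRep (Fin 3)) U 0 1).charpoly.roots.countP
        (fun z : ℂ => z.im = 0 ∧ (∃ f, z.re < -t f) ∧ ∃ g, -t g < z.re) : ℝ)) := by positivity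
  have hnormP : ‖∏ f, det f‖ = ∏ f, ‖det f‖ := norm_prod _ _
  by_cases h : (∏ f, det f).re < 0
  · -- a negative weight: at least one deep or window mode, and `|P| − Re P ≤ 2|P|`
    have hW1 : (1 : ℝ) ≤ (((wilsonDirac (fundamentalRep (Fin 3)) U 0 1).charpoly.roots.countP
          (fun z : ℂ => z.im = 0 ∧ ∀ f, z.re < -t f) : ℝ) +
        ((wilsonDirac (fundamentalRep (Fin 3)) U 0 1).charpoly.roots.countP
          (fun z : ℂ => z.im = 0 ∧ (∃ f, z.re < -t f) ∧ ∃ g, -t g < z.re) : ℝ)) := by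
      exact_mod_cast one_le_countP_deep_add_countP_window_of_re_prod_neg U t h
    have hre : -(∏ f, det f).re ≤ ∏ f, ‖det f‖ := by
      rw [← hnormP]
      exact (neg_le_abs _).trans (Complex.abs_re_le_norm _)
    nlinarith [hre, hA0, hW1]
  · -- non-negative weight: `Re P = |P| = ∏ |det|`
    push Not at h
    have hP : (∏ f, det f).re = ∏ f, ‖det f‖ := by
      rw [← hnormP, ← Complex.abs_re_eq_norm.2 hPim, abs_of_nonneg h]
    rw [hP, sub_self]
    exact mul_nonneg zero_le_two (mul_nonneg hW0 hA0)

/-! ### §3 The integrated deficit bound for three flavours (refined count) -/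

/-- **Positivity deficit ≤ expected deep + window count (three flavours).**  For every torus side, coupling
and bare triple `t`, `(1 − ⟨sign⟩₊)/2 ≤ E₊[DEEP + WINDOW]`, both sides as quotients of Wilson-measure integrals
with the phase-quenched weight `Π_f |det D_W(U,t_f,1)|`, `DEEP = #{real eigenvalues of D_W(U,0,1) below all −t_f}`,
`WINDOW = #{real eigenvalues below some −t_f and above some −t_g}`.  (Integrate §2; both counts are measurable by
§1 and bounded by `12 N⁴`; `Z₊ > 0`.)  The three-flavour refinement of the landed `PositivityDeficitLeDefects`,
which charges every deep crosser once per flavour. -/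
theorem positivityDeficit_le_deepWindowCount_three (β : ℝ) (t : Fin 3 → ℝ) :
    (1 - (∫ U, (∏ f : Fin 3, fermionDet (wilsonDirac (fundamentalRep (Fin 3)) U (t f) 1)).re
        ∂(wilsonMeasure (d := 4) (L := N) (fundamentalRep (Fin 3)) β)) /
      (∫ U, ∏ f : Fin 3, ‖fermionDet (wilsonDirac (fundamentalRep (Fin 3)) U (t f) 1)‖
        ∂(wilsonMeasure (d := 4) (L := N) (fundamentalRep (Fin 3)) β))) / 2 ≤
    (∫ U, (((wilsonDirac (fundamentalRep (Fin 3)) U 0 1).charpoly.roots.countP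
            (fun z : ℂ => z.im = 0 ∧ ∀ f, z.re < -t f) : ℝ) +
          ((wilsonDirac (fundamentalRep (Fin 3)) U 0 1).charpoly.roots.countP
            (fun z : ℂ => z.im = 0 ∧ (∃ f, z.re < -t f) ∧ ∃ g, -t g < z.re) : ℝ)) *
        ∏ f : Fin 3, ‖fermionDet (wilsonDirac (fundamentalRep (Fin 3)) U (t f) 1)‖
        ∂(wilsonMeasure (d := 4) (L := N) (fundamentalRep (Fin 3)) β)) /
      (∫ U, ∏ f : Fin 3, ‖fermionDet (wilsonDirac (fundamentalRep (Fin 3)) U (t f) 1)‖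
        ∂(wilsonMeasure (d := 4) (L := N) (fundamentalRep (Fin 3)) β)) := by
  classical
  set μ := wilsonMeasure (d := 4) (L := N) (fundamentalRep (Fin 3)) β with hμ
  set A : GaugeConfig 4 N (Matrix.specialUnitaryGroup (Fin 3) ℂ) → ℝ := fun U =>
    ∏ f : Fin 3, ‖fermionDet (wilsonDirac (fundamentalRep (Fin 3)) U (t f) 1)‖ with hA
  set R : GaugeConfig 4 N (Matrix.specialUnitaryGroup (Fin 3) ℂ) → ℝ := fun U =>
    (∏ f : Fin 3, fermionDet (wilsonDirac (fundamentalRep (Fin 3)) U (t f) 1)).re with hR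
  set W : GaugeConfig 4 N (Matrix.specialUnitaryGroup (Fin 3) ℂ) → ℝ := fun U =>
    (((wilsonDirac (fundamentalRep (Fin 3)) U 0 1).charpoly.roots.countP
        (fun z : ℂ => z.im = 0 ∧ ∀ f, z.re < -t f) : ℝ) +
      ((wilsonDirac (fundamentalRep (Fin 3)) U 0 1).charpoly.roots.countP
        (fun z : ℂ => z.im = 0 ∧ (∃ f, z.re < -t f) ∧ ∃ g, -t g < z.re) : ℝ)) with hW
  change (1 - (∫ U, R U ∂μ) / (∫ U, A U ∂μ)) / 2 ≤ (∫ U, W U * A U ∂μ) / (∫ U, A U ∂μ)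
  have hAeq : A = fun U => ‖(diracMatrix U t).det‖ := funext fun U => (norm_det_diracMatrix U t).symm
  have hReq : R = fun U => ((diracMatrix U t).det).re := funext fun U => by
    simp only [hR, det_diracMatrix]
  -- positivity of the normalisation
  have hZ : 0 < ∫ U, A U ∂μ := by
    rw [hAeq]; exact integral_norm_det_diracMatrix_pos_all β t
  -- integrability
  have hAi : Integrable A μ := by rw [hAeq]; exact integrable_norm_det_diracMatrix t μ
  have hA0 : ∀ U, 0 ≤ A U := fun U => Finset.prod_nonneg fun f _ => norm_nonneg _
  have hRi : Integrable R μ := by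
    refine hAi.mono' ?_ (Eventually.of_forall fun U => ?_)
    · rw [hReq]
      exact (Complex.continuous_re.comp (continuous_det_diracMatrix t)).aestronglyMeasurable
    · rw [hReq, hAeq, Real.norm_eq_abs]
      exact Complex.abs_re_le_norm _
  have hDm : Measurable fun U : GaugeConfig 4 N (Matrix.specialUnitaryGroup (Fin 3) ℂ) =>
      (((wilsonDirac (fundamentalRep (Fin 3)) U 0 1).charpoly.roots.countP
        (fun z : ℂ => z.im = 0 ∧ ∀ f, z.re < -t f) : ℕ) : ℝ) :=
    (measurable_from_nat (f := (Nat.cast : ℕ → ℝ))).comp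
      (measurable_countP_charpoly_roots_deep
        (continuous_wilsonDirac (fundamentalRep (Fin 3)) (continuous_fundamentalRep (Fin 3)) 0 1) t)
  have hSm : Measurable fun U : GaugeConfig 4 N (Matrix.specialUnitaryGroup (Fin 3) ℂ) =>
      (((wilsonDirac (fundamentalRep (Fin 3)) U 0 1).charpoly.roots.countP
        (fun z : ℂ => z.im = 0 ∧ (∃ f, z.re < -t f) ∧ ∃ g, -t g < z.re) : ℕ) : ℝ) :=
    (measurable_from_nat (f := (Nat.cast : ℕ → ℝ))).comp
      (measurable_countP_charpoly_roots_spread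
        (continuous_wilsonDirac (fundamentalRep (Fin 3)) (continuous_fundamentalRep (Fin 3)) 0 1) t)
  have hWm : Measurable W := hDm.add hSm
  have hW0 : ∀ U, 0 ≤ W U := fun U => by
    simp only [hW]
    positivity
  have hWle : ∀ U, W U ≤ 2 * Fintype.card (TorusSite 4 N × Fin 3 × Fin 4) := by
    intro U
    have h1 := Multiset.countP_le_card (fun z : ℂ => z.im = 0 ∧ ∀ f, z.re < -t f)
      (wilsonDirac (fundamentalRep (Fin 3)) U 0 1).charpoly.roots
    have h2 := Multiset.countP_le_card (fun z : ℂ => z.im = 0 ∧ (∃ f, z.re < -t f) ∧ ∃ g, -t g < z.re)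
      (wilsonDirac (fundamentalRep (Fin 3)) U 0 1).charpoly.roots
    have h3 := Polynomial.card_roots' (wilsonDirac (fundamentalRep (Fin 3)) U 0 1).charpoly
    rw [Matrix.charpoly_natDegree_eq_dim] at h3
    have h1' : (((wilsonDirac (fundamentalRep (Fin 3)) U 0 1).charpoly.roots.countP
        (fun z : ℂ => z.im = 0 ∧ ∀ f, z.re < -t f) : ℕ) : ℝ) ≤
        Fintype.card (TorusSite 4 N × Fin 3 × Fin 4) := by
      exact_mod_cast h1.trans h3
    have h2' : (((wilsonDirac (fundamentalRep (Fin 3)) U 0 1).charpoly.roots.countP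
        (fun z : ℂ => z.im = 0 ∧ (∃ f, z.re < -t f) ∧ ∃ g, -t g < z.re) : ℕ) : ℝ) ≤
        Fintype.card (TorusSite 4 N × Fin 3 × Fin 4) := by
      exact_mod_cast h2.trans h3
    simp only [hW]
    linarith
  have hWAi : Integrable (fun U => W U * A U) μ := by
    refine (hAi.const_mul (2 * Fintype.card (TorusSite 4 N × Fin 3 × Fin 4))).mono'
      (hWm.aestronglyMeasurable.mul hAi.aestronglyMeasurable) (Eventually.of_forall fun U => ?_)
    rw [Real.norm_eq_abs, abs_of_nonneg (mul_nonneg (hW0 U) (hA0 U))]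
    exact mul_le_mul_of_nonneg_right (hWle U) (hA0 U)
  -- integrate the pointwise bound
  have hpt : ∀ U, A U - R U ≤ 2 * (W U * A U) := fun U => by
    have := norm_sub_re_le_two_mul_deepWindowCount_mul_norm U t
    simp only [hA, hR, hW]
    linarith
  have hint : (∫ U, A U ∂μ) - ∫ U, R U ∂μ ≤ 2 * ∫ U, W U * A U ∂μ := by
    rw [← integral_sub hAi hRi, ← integral_const_mul]
    exact integral_mono (hAi.sub hRi) (hWAi.const_mul 2) hpt
  -- divide by `Z₊ > 0`
  rw [le_div_iff₀ hZ]
  have key : (1 - (∫ U, R U ∂μ) / ∫ U, A U ∂μ) / 2 * ∫ U, A U ∂μ = ((∫ U, A U ∂μ) - ∫ U, R U ∂μ) / 2 := by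
    field_simp
  rw [key]
  linarith

/-! ### §4 Sign coherence from a small expected deep + window count (registered sub-goal) -/

/-- **Deep + window ⇒ sign (three flavours)** — registered sub-goal `sign_of_deepWindow_three` of line `Sketch`
of crux stmt-QuantumFields-9150.  For every torus side `N ≥ 1`, coupling `β` and bare triple `t : Fin 3 → ℝ`: if
the phase-quenched (weight `Π_f |det D_W(U,t_f,1)|`) expected number DEEP + WINDOW of real eigenvalues of
`D_W(U,0,1)` that lie below all the `−t_f`, or below some `−t_f` and above some `−t_g`, is `≤ 1/4`, then
`½ ≤ |∫ det diracMatrix dμ_W| / ∫ |det diracMatrix| dμ_W` (`(1 − ⟨sign⟩₊)/2 ≤ 1/4` by §3, and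
`⟨sign⟩₊ = ∫ Re det / ∫ |det| ≤ |∫ det| / ∫ |det|`). -/
theorem sign_of_deepWindow_three : ∀ (N : ℕ) [NeZero N] (β : ℝ) (t : Fin 3 → ℝ), (∫ U : GaugeConfig 4 N (Matrix.specialUnitaryGroup (Fin 3) ℂ), (((wilsonDirac (fundamentalRep (Fin 3)) U 0 1).charpoly.roots.countP (fun z : ℂ => z.im = 0 ∧ ∀ f, z.re < -t f) : ℝ) + ((wilsonDirac (fundamentalRep (Fin 3)) U 0 1).charpoly.roots.countP (fun z : ℂ => z.im = 0 ∧ (∃ f, z.re < -t f) ∧ ∃ g, -t g < z.re) : ℝ)) * ∏ f : Fin 3, ‖fermionDet (wilsonDirac (fundamentalRep (Fin 3)) U (t f) 1)‖ ∂(wilsonMeasure (d := 4) (L := N) (fundamentalRep (Fin 3)) β)) / (∫ U : GaugeConfig 4 N (Matrix.specialUnitaryGroup (Fin 3) ℂ), ∏ f : Fin 3, ‖fermionDet (wilsonDirac (fundamentalRep (Fin 3)) U (t f) 1)‖ ∂(wilsonMeasure (d := 4) (L := N) (fundamentalRep (Fin 3)) β)) ≤ 1 / 4 → (1 / 2 :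 ℝ) ≤ ‖∫ U : GaugeConfig 4 N (Matrix.specialUnitaryGroup (Fin 3) ℂ), (diracMatrix U t).det ∂(wilsonMeasure (fundamentalRep (Fin 3)) β)‖ / (∫ U : GaugeConfig 4 N (Matrix.specialUnitaryGroup (Fin 3) ℂ), ‖(diracMatrix U t).det‖ ∂(wilsonMeasure (fundamentalRep (Fin 3)) β)) := by
  intro N _ β t h
  set μW := wilsonMeasure (d := 4) (L := N) (fundamentalRep (Fin 3)) β with hμW
  have hP := positivityDeficit_le_deepWindowCount_three (N := N) β t
  have hZeq : (∫ U, ∏ f : Fin 3, ‖fermionDet (wilsonDirac (fundamentalRep (Fin 3)) U (t f) 1)‖ ∂μW) =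
      ∫ U, ‖(diracMatrix U t).det‖ ∂μW :=
    integral_congr_ae (Eventually.of_forall fun U => (norm_det_diracMatrix U t).symm)
  have hZ : 0 < ∫ U, ‖(diracMatrix U t).det‖ ∂μW := integral_norm_det_diracMatrix_pos_all β t
  have hdetInt : Integrable (fun U : GaugeConfig 4 N (Matrix.specialUnitaryGroup (Fin 3) ℂ) =>
      (diracMatrix U t).det) μW :=
    (integrable_norm_det_diracMatrix t μW).mono' (continuous_det_diracMatrix t).aestronglyMeasurable
      (Eventually.of_forall fun U => le_rfl)
  have hReq : (∫ U, (∏ f : Fin 3, fermionDet (wilsonDirac (fundamentalRep (Fin 3)) U (t f) 1)).re ∂μW) =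
      (∫ U, (diracMatrix U t).det ∂μW).re := by
    have h1 : (∫ U, (∏ f : Fin 3, fermionDet (wilsonDirac (fundamentalRep (Fin 3)) U (t f) 1)).re ∂μW) =
        ∫ U, ((diracMatrix U t).det).re ∂μW :=
      integral_congr_ae (Eventually.of_forall fun U => by simp only [det_diracMatrix])
    rw [h1]
    have h2 := integral_re hdetInt
    simpa using h2
  have hRle : (∫ U, (∏ f : Fin 3, fermionDet (wilsonDirac (fundamentalRep (Fin 3)) U (t f) 1)).re ∂μW) ≤
      ‖∫ U, (diracMatrix U t).det ∂μW‖ := by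
    rw [hReq]; exact Complex.re_le_norm _
  have hAZ : (1 / 2 : ℝ) ≤
      (∫ U, (∏ f : Fin 3, fermionDet (wilsonDirac (fundamentalRep (Fin 3)) U (t f) 1)).re ∂μW) /
        (∫ U, ∏ f : Fin 3, ‖fermionDet (wilsonDirac (fundamentalRep (Fin 3)) U (t f) 1)‖ ∂μW) := by
    linarith [hP.trans h]
  rw [hZeq] at hAZ
  exact hAZ.trans (div_le_div_of_nonneg_right hRle hZ.le)

end Summit.QuantumFields.QCD.Theorems.MobilityGapSketch

end
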